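import Mathlib
import Summits.ValiantsHypothesis.ValiantsHypothesis.Theorems.NewtonUnitEquationsDissociatedUniformStubCellDecomposition
import Summits.ValiantsHypothesis.ValiantsHypothesis.Theorems.NewtonUnitEquationsDissociatedUniformGenericCode

/-!
# Generic stratum of crux `DissociatedUniform`: a polynomial bound, uniformly in `k`

Crux stmt-ValiantsHypothesis-5905 (`NewtonUnitEquations.DissociatedUniform`), line `greedy-basis-shadow` (lead c5).
**Theorem (generic stratum).**  On a dissociated frame `A : Fin m → Finset ℕ²` with `|A j| ≤ t`, if every `k` words of
the box have linearly independent coefficient columns `col f` (coefficients in general position), then the Newton polygon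
of `Σ_{i<k} Π_j f_ij` has at most `(k·m·t + 2)^16` vertices (`dissociated_generic`) — the crux's bound with an ABSOLUTE
exponent on this stratum.  Proof: vertices are frame-shadow points (tree, Theorem Q §E); chart + cell decomposition (tree,
`CellDecomposition.ncard_pencil_le`); under general position the lex-greedy set of an injective height is the set of
top-`k` words (`card_filter_lt_of_mem_gE`); and in one cell all heights are comparison-equivalent, so the top-`k` words
met along the cell inject into the code space of `Generic.ncard_topWords_le` (`perCell_generic`).  The complementary
(rank-deficient, "design") configurations are exactly where the registered stub `stub_perCellBound` remains open.
-/

noncomputable section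

open scoped BigOperators

-- Sub = Summit single-conjunct layout: the duplicated namespace component is mandated by the tree.
set_option linter.dupNamespace false

namespace Summit.ValiantsHypothesis.ValiantsHypothesis.Theorems.NewtonUnitEquationsDissociatedUniform

namespace Generic

/-- The word height of the chart is the additive height of `letterHeight`. -/
theorem Hw_letterHeight {m : ℕ} (ε lam : ℝ) :
    Hw (letterHeight ε lam) = fun a : Fin m → (Fin 2 →₀ ℕ) => ε * QuasiPoly.Xf a + lam * QuasiPoly.Yf a := by
  funext a
  simp only [Hw, letterHeight, QuasiPoly.Xf, QuasiPoly.Yf, Finsupp.coe_finsetSum, Finset.sum_apply, Nat.cast_sum,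
    Finset.sum_add_distrib, Finset.mul_sum]

/-- In a cell, the letter heights at two parameters are comparison-equivalent. -/
theorem hc_of_cell {m : ℕ} (A : Fin m → Finset (Fin 2 →₀ ℕ)) (ε : ℝ) (Λ : Set ℝ)
    (hcell : ∀ (j j' : Fin m), ∀ l₁ ∈ A j, ∀ l₂ ∈ A j, ∀ l₃ ∈ A j', ∀ l₄ ∈ A j', ∀ lam ∈ Λ, ∀ lam' ∈ Λ,
      ((ε * ((((l₁ 0 : ℕ) : ℝ)) - (((l₂ 0 : ℕ) : ℝ)) - (((l₃ 0 : ℕ) : ℝ)) + (((l₄ 0 : ℕ) : ℝ))) +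
          lam * ((((l₁ 1 : ℕ) : ℝ)) - (((l₂ 1 : ℕ) : ℝ)) - (((l₃ 1 : ℕ) : ℝ)) + (((l₄ 1 : ℕ) : ℝ))) < 0 ↔
        ε * ((((l₁ 0 : ℕ) : ℝ)) - (((l₂ 0 : ℕ) : ℝ)) - (((l₃ 0 : ℕ) : ℝ)) + (((l₄ 0 : ℕ) : ℝ))) +
          lam' * ((((l₁ 1 : ℕ) : ℝ)) - (((l₂ 1 : ℕ) : ℝ)) - (((l₃ 1 : ℕ) : ℝ)) + (((l₄ 1 : ℕ) : ℝ))) < 0) ∧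
      (0 < ε * ((((l₁ 0 : ℕ) : ℝ)) - (((l₂ 0 : ℕ) : ℝ)) - (((l₃ 0 : ℕ) : ℝ)) + (((l₄ 0 : ℕ) : ℝ))) +
          lam * ((((l₁ 1 : ℕ) : ℝ)) - (((l₂ 1 : ℕ) : ℝ)) - (((l₃ 1 : ℕ) : ℝ)) + (((l₄ 1 : ℕ) : ℝ))) ↔
        0 < ε * ((((l₁ 0 : ℕ) : ℝ)) - (((l₂ 0 : ℕ) : ℝ)) - (((l₃ 0 : ℕ) : ℝ)) + (((l₄ 0 : ℕ) : ℝ))) +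
          lam' * ((((l₁ 1 : ℕ) : ℝ)) - (((l₂ 1 : ℕ) : ℝ)) - (((l₃ 1 : ℕ) : ℝ)) + (((l₄ 1 : ℕ) : ℝ))))))
    {lam₀ lam : ℝ} (h₀ : lam₀ ∈ Λ) (h : lam ∈ Λ) :
    ∀ (j j' : Fin m), ∀ l₁ ∈ A j, ∀ l₂ ∈ A j, ∀ l₃ ∈ A j', ∀ l₄ ∈ A j',
      (letterHeight ε lam₀ l₁ - letterHeight ε lam₀ l₂ < letterHeight ε lam₀ l₃ - letterHeight ε lam₀ l₄ ↔
        letterHeight ε lam l₁ - letterHeight ε lam l₂ < letterHeight ε lam l₃ - letterHeight ε lam l₄) := by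
  intro j j' l₁ h₁ l₂ h₂ l₃ h₃ l₄ h₄
  have key : ∀ μ : ℝ, (letterHeight ε μ l₁ - letterHeight ε μ l₂ < letterHeight ε μ l₃ - letterHeight ε μ l₄ ↔
      ε * ((((l₁ 0 : ℕ) : ℝ)) - (((l₂ 0 : ℕ) : ℝ)) - (((l₃ 0 : ℕ) : ℝ)) + (((l₄ 0 : ℕ) : ℝ))) +
        μ * ((((l₁ 1 : ℕ) : ℝ)) - (((l₂ 1 : ℕ) : ℝ)) - (((l₃ 1 : ℕ) : ℝ)) + (((l₄ 1 : ℕ) : ℝ))) < 0) := by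
    intro μ
    rw [← sub_neg]
    have : letterHeight ε μ l₁ - letterHeight ε μ l₂ - (letterHeight ε μ l₃ - letterHeight ε μ l₄) =
        ε * ((((l₁ 0 : ℕ) : ℝ)) - (((l₂ 0 : ℕ) : ℝ)) - (((l₃ 0 : ℕ) : ℝ)) + (((l₄ 0 : ℕ) : ℝ))) +
          μ * ((((l₁ 1 : ℕ) : ℝ)) - (((l₂ 1 : ℕ) : ℝ)) - (((l₃ 1 : ℕ) : ℝ)) + (((l₄ 1 : ℕ) : ℝ))) := by
      simp only [letterHeight]; ring
    rw [this]
  rw [key lam₀, key lam]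
  exact (hcell j j' l₁ h₁ l₂ h₂ l₃ h₃ l₄ h₄ lam₀ h₀ lam h).1

/-- The size of the code space in closed form: `(log₂ k + 1) · (2^(log₂ k + 1) k²)² ≤ (k + 2)^9`. -/
theorem codeBound_le (k : ℕ) : (Nat.log 2 k + 1) * (2 ^ (Nat.log 2 k + 1) * k ^ 2) ^ 2 ≤ (k + 2) ^ 9 := by
  rcases Nat.eq_zero_or_pos k with rfl | hk
  · simp
  have h1 : Nat.log 2 k + 1 ≤ k + 2 := by have := Nat.log_le_self 2 k; omega
  have h2 : 2 ^ (Nat.log 2 k + 1) ≤ 2 * k := by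
    rw [pow_succ]; have := Nat.pow_log_le_self 2 hk.ne'; omega
  have h3 : (2 ^ (Nat.log 2 k + 1) * k ^ 2) ^ 2 ≤ (k + 2) ^ 8 := by
    calc (2 ^ (Nat.log 2 k + 1) * k ^ 2) ^ 2 ≤ (2 * k * k ^ 2) ^ 2 := Nat.pow_le_pow_left (Nat.mul_le_mul_right _ h2) 2
      _ = 4 * k ^ 6 := by ring
      _ ≤ (k + 2) ^ 2 * (k + 2) ^ 6 := Nat.mul_le_mul (by nlinarith) (Nat.pow_le_pow_left (by omega) 6)
      _ = (k + 2) ^ 8 := by ring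
  calc (Nat.log 2 k + 1) * (2 ^ (Nat.log 2 k + 1) * k ^ 2) ^ 2 ≤ (k + 2) * (k + 2) ^ 8 := Nat.mul_le_mul h1 h3
    _ = (k + 2) ^ 9 := by ring

/-- **Per-cell bound, generic stratum.**  Under general position, the lex-greedy words met at the injective parameters
of one cell `Λ` of the chart `a ↦ ε X(a) + λ Y(a)` number at most `(k + 2)^9`. -/
theorem perCell_generic (k m : ℕ) (A : Fin m → Finset (Fin 2 →₀ ℕ)) (f : Fin k → Fin m → MvPolynomial (Fin 2) ℂ)
    (hgen : ∀ S : Finset (Fin m → (Fin 2 →₀ ℕ)), S ⊆ Fintype.piFinset A → S.card = k →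
      LinearIndependent ℂ (fun a : S => QuasiPoly.col f a))
    (ε : ℝ) (Λ : Set ℝ)
    (hcell : ∀ (j j' : Fin m), ∀ l₁ ∈ A j, ∀ l₂ ∈ A j, ∀ l₃ ∈ A j', ∀ l₄ ∈ A j', ∀ lam ∈ Λ, ∀ lam' ∈ Λ,
      ((ε * ((((l₁ 0 : ℕ) : ℝ)) - (((l₂ 0 : ℕ) : ℝ)) - (((l₃ 0 : ℕ) : ℝ)) + (((l₄ 0 : ℕ) : ℝ))) +
          lam * ((((l₁ 1 : ℕ) : ℝ)) - (((l₂ 1 : ℕ) : ℝ)) - (((l₃ 1 : ℕ) : ℝ)) + (((l₄ 1 : ℕ) : ℝ))) < 0 ↔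
        ε * ((((l₁ 0 : ℕ) : ℝ)) - (((l₂ 0 : ℕ) : ℝ)) - (((l₃ 0 : ℕ) : ℝ)) + (((l₄ 0 : ℕ) : ℝ))) +
          lam' * ((((l₁ 1 : ℕ) : ℝ)) - (((l₂ 1 : ℕ) : ℝ)) - (((l₃ 1 : ℕ) : ℝ)) + (((l₄ 1 : ℕ) : ℝ))) < 0) ∧
      (0 < ε * ((((l₁ 0 : ℕ) : ℝ)) - (((l₂ 0 : ℕ) : ℝ)) - (((l₃ 0 : ℕ) : ℝ)) + (((l₄ 0 : ℕ) : ℝ))) +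
          lam * ((((l₁ 1 : ℕ) : ℝ)) - (((l₂ 1 : ℕ) : ℝ)) - (((l₃ 1 : ℕ) : ℝ)) + (((l₄ 1 : ℕ) : ℝ))) ↔
        0 < ε * ((((l₁ 0 : ℕ) : ℝ)) - (((l₂ 0 : ℕ) : ℝ)) - (((l₃ 0 : ℕ) : ℝ)) + (((l₄ 0 : ℕ) : ℝ))) +
          lam' * ((((l₁ 1 : ℕ) : ℝ)) - (((l₂ 1 : ℕ) : ℝ)) - (((l₃ 1 : ℕ) : ℝ)) + (((l₄ 1 : ℕ) : ℝ)))))) :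
    {a : Fin m → (Fin 2 →₀ ℕ) | ∃ lam ∈ Λ,
        Set.InjOn (fun a : Fin m → (Fin 2 →₀ ℕ) => ε * QuasiPoly.Xf a + lam * QuasiPoly.Yf a) (Fintype.piFinset A) ∧
        a ∈ QuasiPoly.gE (Fintype.piFinset A) (QuasiPoly.col f)
          (fun a : Fin m → (Fin 2 →₀ ℕ) => ε * QuasiPoly.Xf a + lam * QuasiPoly.Yf a)}.ncard ≤ (k + 2) ^ 9 := by
  classical
  set S := {a : Fin m → (Fin 2 →₀ ℕ) | ∃ lam ∈ Λ,
        Set.InjOn (fun a : Fin m → (Fin 2 →₀ ℕ) => ε * QuasiPoly.Xf a + lam * QuasiPoly.Yf a) (Fintype.piFinset A) ∧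
        a ∈ QuasiPoly.gE (Fintype.piFinset A) (QuasiPoly.col f)
          (fun a : Fin m → (Fin 2 →₀ ℕ) => ε * QuasiPoly.Xf a + lam * QuasiPoly.Yf a)} with hS
  rcases S.eq_empty_or_nonempty with hempty | ⟨a₁, lam₀, hlam₀, hinj₀, ha₁⟩
  · rw [hempty, Set.ncard_empty]; exact Nat.zero_le _
  -- the reference height `φ = letterHeight ε lam₀`
  have hH : ∀ lam : ℝ, (fun a : Fin m → (Fin 2 →₀ ℕ) => ε * QuasiPoly.Xf a + lam * QuasiPoly.Yf a) =
      Hw (letterHeight ε lam) := fun lam => (Hw_letterHeight ε lam).symm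
  have hinjφ : Set.InjOn (Hw (letterHeight ε lam₀)) (Fintype.piFinset A : Set (Fin m → (Fin 2 →₀ ℕ))) := by
    rw [← hH lam₀]; exact hinj₀
  have hbox₁ : a₁ ∈ Fintype.piFinset A := ha₁.1
  have hne : ∀ j, (A j).Nonempty := Fintype.piFinset_nonempty.mp ⟨a₁, hbox₁⟩
  have hsub : S ⊆ {a : Fin m → (Fin 2 →₀ ℕ) | a ∈ Fintype.piFinset A ∧ ∃ ψ : (Fin 2 →₀ ℕ) → ℝ,
      (∀ (j j' : Fin m), ∀ l₁ ∈ A j, ∀ l₂ ∈ A j, ∀ l₃ ∈ A j', ∀ l₄ ∈ A j',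
        (letterHeight ε lam₀ l₁ - letterHeight ε lam₀ l₂ < letterHeight ε lam₀ l₃ - letterHeight ε lam₀ l₄ ↔
          ψ l₁ - ψ l₂ < ψ l₃ - ψ l₄)) ∧
      Set.InjOn (Hw ψ) (Fintype.piFinset A : Set (Fin m → (Fin 2 →₀ ℕ))) ∧
      ((Fintype.piFinset A).filter fun b => Hw ψ a < Hw ψ b).card < k} := by
    rintro a ⟨lam, hlam, hinj, ha⟩
    refine ⟨ha.1, letterHeight ε lam, hc_of_cell A ε Λ hcell hlam₀ hlam, by rw [← hH lam]; exact hinj, ?_⟩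
    have h := card_filter_lt_of_mem_gE (Fintype.piFinset A) (QuasiPoly.col f) _ hgen ha
    simpa only [Hw_letterHeight] using h
  calc S.ncard ≤ _ := Set.ncard_le_ncard hsub ((Fintype.piFinset A).finite_toSet.subset fun a ha => ha.1)
    _ ≤ (Nat.log 2 k + 1) * (2 ^ (Nat.log 2 k + 1) * k ^ 2) ^ 2 := ncard_topWords_le hinjφ hne k
    _ ≤ (k + 2) ^ 9 := codeBound_le k

/-- **Frame shadow bound, generic stratum** (cells × per-cell bound; `t` letters per coordinate). -/
theorem ncard_fshadow_generic (k m t : ℕ) (A : Fin m → Finset (Fin 2 →₀ ℕ)) (f : Fin k → Fin m → MvPolynomial (Fin 2) ℂ)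
    (hcard : ∀ j, (A j).card ≤ t)
    (hgen : ∀ S : Finset (Fin m → (Fin 2 →₀ ℕ)), S ⊆ Fintype.piFinset A → S.card = k →
      LinearIndependent ℂ (fun a : S => QuasiPoly.col f a)) :
    (QuasiPoly.fshadow A f).ncard ≤ 2 * (((m * t ^ 2) ^ 2 + 1) * (k + 2) ^ 9 + (m * t ^ 2) ^ 2 * k) + k + k + 1 := by
  have hchart : ∀ ε : ℝ, ∀ u : (Fin m → (Fin 2 →₀ ℕ)) → ℝ, (∀ a, u a = ε * QuasiPoly.Xf a) →
      (QuasiPoly.chartShadow (Fintype.piFinset A) (QuasiPoly.col f) u QuasiPoly.Yf).ncard ≤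
        ((m * t ^ 2) ^ 2 + 1) * (k + 2) ^ 9 + (m * t ^ 2) ^ 2 * k := by
    intro ε u hu
    have hH : ∀ lam : ℝ, (fun e : Fin m → (Fin 2 →₀ ℕ) => u e + lam * QuasiPoly.Yf e) =
        fun a : Fin m → (Fin 2 →₀ ℕ) => ε * QuasiPoly.Xf a + lam * QuasiPoly.Yf a := by
      intro lam; funext a; rw [hu]
    exact le_trans
      (Set.ncard_le_ncard
        (CellDecomposition.chartShadow_subset_pencil (Fintype.piFinset A) (QuasiPoly.col f) u QuasiPoly.Yf
          (fun (lam : ℝ) (a : Fin m → (Fin 2 →₀ ℕ)) => ε * QuasiPoly.Xf a + lam * QuasiPoly.Yf a) hH)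
        (CellDecomposition.pencil_finite _ _ _))
      (CellDecomposition.ncard_pencil_le (Fintype.piFinset A) (QuasiPoly.col f)
        (fun (lam : ℝ) (a : Fin m → (Fin 2 →₀ ℕ)) => ε * QuasiPoly.Xf a + lam * QuasiPoly.Yf a) A
        (fun l : Fin 2 →₀ ℕ => ((l 0 : ℕ) : ℝ)) (fun l : Fin 2 →₀ ℕ => ((l 1 : ℕ) : ℝ)) ε ((k + 2) ^ 9) t hcard
        (fun Λ hc => perCell_generic k m A f hgen ε Λ hc))
  have hpos := hchart 1 QuasiPoly.Xf fun a => (one_mul _).symm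
  have hneg := hchart (-1) (fun e => -QuasiPoly.Xf e) fun a => (neg_one_mul _).symm
  have hdec := QuasiPoly.ncard_cshadow_le_charts (Fintype.piFinset A) (QuasiPoly.col f) QuasiPoly.Xf QuasiPoly.Yf
  calc (QuasiPoly.fshadow A f).ncard
      = (QuasiPoly.cshadow (Fintype.piFinset A) (QuasiPoly.col f) QuasiPoly.Xf QuasiPoly.Yf).ncard := rfl
    _ ≤ _ := hdec
    _ ≤ (((m * t ^ 2) ^ 2 + 1) * (k + 2) ^ 9 + (m * t ^ 2) ^ 2 * k) +
          (((m * t ^ 2) ^ 2 + 1) * (k + 2) ^ 9 + (m * t ^ 2) ^ 2 * k) + k + k + 1 := by gcongr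
    _ = 2 * (((m * t ^ 2) ^ 2 + 1) * (k + 2) ^ 9 + (m * t ^ 2) ^ 2 * k) + k + k + 1 := by ring

/-- Arithmetic of the final bound: with `x = k·m·t + 2 ≥ k + 2, m·t², 3`, the shadow bound is at most `x^16`. -/
theorem generic_arith (k m t x : ℕ) (hx3 : 3 ≤ x) (hk : k + 2 ≤ x) (hmt : m * t ^ 2 ≤ x ^ 2) :
    2 * (((m * t ^ 2) ^ 2 + 1) * (k + 2) ^ 9 + (m * t ^ 2) ^ 2 * k) + k + k + 1 ≤ x ^ 16 := by
  have h1 : (m * t ^ 2) ^ 2 ≤ x ^ 4 := by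
    calc (m * t ^ 2) ^ 2 ≤ (x ^ 2) ^ 2 := Nat.pow_le_pow_left hmt 2
      _ = x ^ 4 := by ring
  have h2 : (k + 2) ^ 9 ≤ x ^ 9 := Nat.pow_le_pow_left hk 9
  have hk' : k ≤ x := by omega
  have h3 : (m * t ^ 2) ^ 2 + 1 ≤ 2 * x ^ 4 := by
    have : 1 ≤ x ^ 4 := Nat.one_le_pow _ _ (by omega)
    omega
  calc 2 * (((m * t ^ 2) ^ 2 + 1) * (k + 2) ^ 9 + (m * t ^ 2) ^ 2 * k) + k + k + 1
      ≤ 2 * ((2 * x ^ 4) * x ^ 9 + x ^ 4 * x) + x + x + x := by gcongr; omega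
    _ = 4 * x ^ 13 + 2 * x ^ 5 + 3 * x := by ring
    _ ≤ x ^ 2 * x ^ 13 + x * x ^ 5 + x * x := by
        have h9 : 4 ≤ x ^ 2 := by nlinarith
        have hb : 2 * x ^ 5 ≤ x * x ^ 5 := Nat.mul_le_mul_right _ (by omega)
        have hc : 3 * x ≤ x * x := Nat.mul_le_mul_right _ hx3
        have ha : 4 * x ^ 13 ≤ x ^ 2 * x ^ 13 := Nat.mul_le_mul_right _ h9
        omega
    _ = x ^ 15 + x ^ 6 + x ^ 2 := by ring
    _ ≤ x ^ 15 + x ^ 15 + x ^ 15 := by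
        gcongr <;> omega
    _ = 3 * x ^ 15 := by ring
    _ ≤ x * x ^ 15 := Nat.mul_le_mul_right _ hx3
    _ = x ^ 16 := by ring

/-- **Generic stratum of `DissociatedUniform` (by-product of line `greedy-basis-shadow`).**  On a dissociated frame
`A : Fin m → Finset ℕ²` with at most `t` letters per coordinate, if every `k` words of the box `Π_j A_j` have linearly
independent coefficient columns `(Π_j coeff_{a_j} f_ij)_{i<k}`, then the Newton polygon of `Σ_{i<k} Π_{j<m} f_ij` has at
most `(k·m·t + 2)^16` vertices — the crux's conclusion with the absolute exponent `C = 16` on the general-position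
stratum (no hypothesis relating `t` and `k`). -/
theorem dissociated_generic (k m t : ℕ) (A : Fin m → Finset (Fin 2 →₀ ℕ))
    (f : Fin k → Fin m → MvPolynomial (Fin 2) ℂ) (hcard : ∀ j, (A j).card ≤ t)
    (hsupp : ∀ i j, (f i j).support ⊆ A j)
    (hdis : ∀ a b : Fin m → (Fin 2 →₀ ℕ), (∀ j, a j ∈ A j) → (∀ j, b j ∈ A j) → ∑ j, a j = ∑ j, b j → a = b)
    (hgen : ∀ S : Finset (Fin m → (Fin 2 →₀ ℕ)), S ⊆ Fintype.piFinset A → S.card = k →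
      LinearIndependent ℂ (fun a : S => QuasiPoly.col f a)) :
    (Set.extremePoints ℝ (convexHull ℝ ((fun e : Fin 2 →₀ ℕ => fun i : Fin 2 => ((e i : ℕ) : ℝ)) ''
      ((∑ i, ∏ j, f i j).support : Set (Fin 2 →₀ ℕ))))).ncard ≤ (k * m * t + 2) ^ 16 := by
  classical
  have hvert : (Set.extremePoints ℝ (convexHull ℝ ((fun e : Fin 2 →₀ ℕ => fun i : Fin 2 => ((e i : ℕ) : ℝ)) ''
        ((∑ i, ∏ j, f i j).support : Set (Fin 2 →₀ ℕ))))).ncard ≤ (QuasiPoly.fshadow A f).ncard :=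
    calc (Set.extremePoints ℝ (convexHull ℝ ((fun e : Fin 2 →₀ ℕ => fun i : Fin 2 => ((e i : ℕ) : ℝ)) ''
          ((∑ i, ∏ j, f i j).support : Set (Fin 2 →₀ ℕ))))).ncard
        ≤ ((fun a : Fin m → (Fin 2 →₀ ℕ) => fun i : Fin 2 => (((∑ j, a j) i : ℕ) : ℝ)) '' QuasiPoly.fshadow A f).ncard :=
          Set.ncard_le_ncard (QuasiPoly.extremePoints_subset_image_fshadow A f hsupp hdis)
            ((QuasiPoly.cshadow_finite _ _ _ _).image _)
      _ ≤ (QuasiPoly.fshadow A f).ncard := Set.ncard_image_le (QuasiPoly.cshadow_finite _ _ _ _)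
  have htriv : (QuasiPoly.fshadow A f).ncard ≤ t ^ m := QuasiPoly.ncard_fshadow_le_pow t A f hcard
  rcases Nat.eq_zero_or_pos m with rfl | hm
  · -- `m = 0`: one word
    calc _ ≤ (QuasiPoly.fshadow A f).ncard := hvert
      _ ≤ 1 := by simpa using htriv
      _ ≤ (k * 0 * t + 2) ^ 16 := Nat.one_le_pow _ _ (by omega)
  rcases Nat.eq_zero_or_pos t with rfl | ht
  · -- `t = 0 < m`: empty box
    calc _ ≤ (QuasiPoly.fshadow A f).ncard := hvert
      _ ≤ 0 := by simpa [Nat.pos_iff_ne_zero.mp hm] using htriv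
      _ ≤ (k * m * 0 + 2) ^ 16 := Nat.zero_le _
  rcases Nat.eq_zero_or_pos k with rfl | hk
  · -- `k = 0`: no lex-greedy words at all (the columns live in the zero space)
    have hempty : QuasiPoly.fshadow A f = ∅ := by
      apply Set.subset_empty_iff.mp
      rintro a ⟨w, _, ha⟩
      exact ha.2 (by rw [Subsingleton.elim (QuasiPoly.col f a) 0]; exact Submodule.zero_mem _)
    calc _ ≤ (QuasiPoly.fshadow A f).ncard := hvert
      _ = 0 := by rw [hempty, Set.ncard_empty]
      _ ≤ (0 * m * t + 2) ^ 16 := Nat.zero_le _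
  -- main case
  set x := k * m * t + 2 with hx
  have hkmt : 1 ≤ k * m * t := Nat.mul_pos (Nat.mul_pos hk hm) ht
  have hx3 : 3 ≤ x := by omega
  have hk2 : k + 2 ≤ x := by
    have : k ≤ k * m * t := by
      calc k = k * 1 * 1 := by ring
        _ ≤ k * m * t := Nat.mul_le_mul (Nat.mul_le_mul le_rfl hm) ht
    omega
  have hmt : m * t ^ 2 ≤ x ^ 2 := by
    have h1 : m * t ≤ x := by
      have : m * t ≤ k * m * t := by
        calc m * t = 1 * m * t := by ring
          _ ≤ k * m * t := Nat.mul_le_mul (Nat.mul_le_mul hk le_rfl) le_rfl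
      omega
    have h2 : t ≤ x := by
      have : t ≤ k * m * t := by
        calc t = 1 * 1 * t := by ring
          _ ≤ k * m * t := Nat.mul_le_mul (Nat.mul_le_mul hk hm) le_rfl
      omega
    calc m * t ^ 2 = (m * t) * t := by ring
      _ ≤ x * x := Nat.mul_le_mul h1 h2
      _ = x ^ 2 := by ring
  calc _ ≤ (QuasiPoly.fshadow A f).ncard := hvert
    _ ≤ 2 * (((m * t ^ 2) ^ 2 + 1) * (k + 2) ^ 9 + (m * t ^ 2) ^ 2 * k) + k + k + 1 :=
        ncard_fshadow_generic k m t A f hcard hgen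
    _ ≤ x ^ 16 := generic_arith k m t x hx3 hk2 hmt

end Generic

/-- **Generic stratum of the crux, exported in the crux's own shape** (definition-free except for the general-position
hypothesis on the Khatri–Rao columns `QuasiPoly.col f`): `DissociatedUniform`'s conclusion with `C = 16` holds for every
dissociated frame whose coefficient tensor is in general position (every `k` words have independent columns). -/
theorem dissociatedUniform_generic (k m t : ℕ) (A : Fin m → Finset (Fin 2 →₀ ℕ))
    (f : Fin k → Fin m → MvPolynomial (Fin 2) ℂ) (hcard : ∀ j, (A j).card ≤ t)
    (hsupp : ∀ i j, (f i j).support ⊆ A j)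
    (hdis : ∀ a b : Fin m → (Fin 2 →₀ ℕ), (∀ j, a j ∈ A j) → (∀ j, b j ∈ A j) → ∑ j, a j = ∑ j, b j → a = b)
    (hgen : ∀ S : Finset (Fin m → (Fin 2 →₀ ℕ)), S ⊆ Fintype.piFinset A → S.card = k →
      LinearIndependent ℂ (fun a : S => QuasiPoly.col f a)) :
    (Set.extremePoints ℝ (convexHull ℝ ((fun e : Fin 2 →₀ ℕ => fun i : Fin 2 => ((e i : ℕ) : ℝ)) ''
      ((∑ i, ∏ j, f i j).support : Set (Fin 2 →₀ ℕ))))).ncard ≤ (k * m * t + 2) ^ 16 :=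
  Generic.dissociated_generic k m t A f hcard hsupp hdis hgen

end Summit.ValiantsHypothesis.ValiantsHypothesis.Theorems.NewtonUnitEquationsDissociatedUniform

end
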